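import Literature.Analysis.FluidPDE.AxisymmetricL3Gauge
import Literature.Analysis.FluidPDE.AxisymmetricTypeIPressureBounds
import Literature.Analysis.FluidPDE.RieszPressureL3
import Literature.Analysis.FluidPDE.RieszPressureSpaceTimeLp
import HarnessLib

/-!
# `u ∈ L³` and the gauged pressure in `L^{3/2}` on backward cylinders touching the final time —
# without a Type I assumption

Analysis/FluidPDE proofs-layer file on the discharge path of
`Literature.Analysis.FluidPDE.LeiZhang2011_regularity_bmoStream`. The Type I programme
(`AxisymmetricTypeIPressureBounds`) bounds the normalised pressure in `L^{3/2}_t L²_x` through the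
rate `|u| ≤ C/√(T−t)`; for a general Leray–Hopf solution one has instead `u ∈ L³((0, T) × ℝ³)`
and hence, by the Calderón–Zygmund bound of Stein (`eLpNorm_normalisedPressure_le_steinConst'`,
extended from test fields to smooth finite-energy fields by cut-off and Fatou),
`p̃[u(t)] ∈ L^{3/2}((0, T) × ℝ³)`. This suffices for the two consumers: the gauged pressure is in
`L^{3/2}` of every backward cylinder with top time `T` (hypothesis of the ε-regularity criteria)
and its tails at spatial infinity are small.

* `eLpNorm_normalisedPressure_threeHalves_le_of_integrable` — `‖p̃[w]‖_{3/2} ≤ C_{3/2} ‖w‖₃²` for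
  `w ∈ C^∞` with `|w|² ∈ L¹`;
* `AxisymmetricL3Hyp.integrable_norm_sq`, `.lintegral_Ioo_eLpNorm_normalisedPressure_threeHalves_rpow_lt_top`
  — `∫₀ᵀ ‖p̃[u(t)]‖_{3/2}^{3/2} dt ≤ C_{3/2}^{3/2} ∫₀ᵀ ∫ |u|³ < ∞`;
* `AxisymmetricL3Hyp.lintegral_cylinder_enorm_pow_three_lt_top`,
  `.lintegral_cylinder_gauged_pressure_lt_top` — `u ∈ L³`, `q ∈ L^{3/2}` of `Q_r(T, x₀)`
  (`r² ≤ T`), same statements as in the Type I file;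
* `AxisymmetricL3Hyp.lintegral_Ioo_setLIntegral_gauged_pressure_lt_top` — `q ∈ L^{3/2}` of the
  final slab, for the tails.

## References

* E. M. Stein, *Singular Integrals and Differentiability Properties of Functions* (1970),
  Ch. II §4.2 Thm. 3. [Stein1971]
* G. Seregin, V. Šverák, Comm. PDE 34 (2009), Thm. 3.1 (hypotheses `v ∈ L³`, `q ∈ L^{3/2}`).
  [SereginSverak2009]
-/

noncomputable section

open MeasureTheory Set Function Filter Topology TopologicalSpace Metric
open scoped NNReal ENNReal

namespace Literature.Analysis.FluidPDE

/-- Local notation for physical space `ℝ³ = EuclideanSpace ℝ (Fin 3)`. -/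
local notation "ℝ³" => EuclideanSpace ℝ (Fin 3)

/-! ### The `L^{3/2}` bound of the normalised pressure of a smooth finite-energy field -/

/-- **`‖p̃[w]‖_{L^{3/2}} ≤ C_{3/2} ‖w‖_{L³}²` for `w ∈ C^∞(ℝ³; ℝ³)` with `|w|² ∈ L¹`** — Stein's
bound for test fields (`eLpNorm_normalisedPressure_le_steinConst'`) extended by cut-off
(`p̃[χ_{n+1} w] → p̃[w]` pointwise, `tendsto_normalisedPressure_cutoff`) and Fatou; both sides
may be infinite. [cite: Stein1971, Ch. II §4.2 Thm. 3] -/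
theorem eLpNorm_normalisedPressure_threeHalves_le_of_integrable {w : ℝ³ → ℝ³}
    (hw : ContDiff ℝ (⊤ : ℕ∞) w) (hL2 : Integrable fun y => ‖w y‖ ^ 2) :
    eLpNorm (normalisedPressure w) (3 / 2 : ℝ≥0∞) volume ≤
      steinConstThreeHalves * eLpNorm w 3 volume ^ 2 := by
  set f : ℕ → ℝ³ → ℝ := fun n => normalisedPressure (fun y => cutoff ((n : ℝ) + 1) y • w y)
    with hf
  have hmeas : ∀ n, AEStronglyMeasurable (f n) volume := fun n =>
    aestronglyMeasurable_normalisedPressure (contDiff_cutoff_smul hw _)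
      (hasCompactSupport_cutoff_smul (Nat.cast_add_one_pos n))
  have hlim : ∀ᵐ x ∂(volume : Measure ℝ³), Tendsto (fun n => f n x) atTop
      (𝓝 (normalisedPressure w x)) :=
    ae_of_all _ fun x => tendsto_normalisedPressure_cutoff hw hL2 x
  refine (MeasureTheory.Lp.eLpNorm_lim_le_liminf_eLpNorm hmeas _ hlim).trans ?_
  refine liminf_le_of_frequently_le' (Eventually.of_forall fun n => ?_).frequently
  have hwn : ContDiff ℝ (⊤ : ℕ∞) (fun y => cutoff ((n : ℝ) + 1) y • w y) :=
    contDiff_cutoff_smul hw _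
  calc eLpNorm (f n) (3 / 2 : ℝ≥0∞) volume
      ≤ steinConstThreeHalves * eLpNorm (fun y => cutoff ((n : ℝ) + 1) y • w y) 3 volume ^ 2 :=
        eLpNorm_normalisedPressure_le_steinConst' hwn
          (hasCompactSupport_cutoff_smul (Nat.cast_add_one_pos n))
    _ ≤ steinConstThreeHalves * eLpNorm w 3 volume ^ 2 := by
        gcongr
        exact eLpNorm_mono fun y => norm_cutoff_smul_le _ y

namespace AxisymmetricL3Hyp

variable {ν T : ℝ} {u : ℝ → ℝ³ → ℝ³} {p : ℝ → ℝ³ → ℝ}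

/-- The smooth slices have `|u(t)|² ∈ L¹` (finite energy). [folklore] -/
theorem integrable_norm_sq (H : AxisymmetricL3Hyp ν T u p) {t : ℝ} (ht : t ∈ Ico 0 T) :
    Integrable (fun x => ‖u t x‖ ^ 2) (volume : Measure ℝ³) := by
  have hmem : MemLp (u t) 2 volume := H.lerayHopf.memLp t ⟨ht.1, ht.2.le⟩
  simpa using hmem.integrable_norm_pow two_ne_zero

/-- **`p̃[u] ∈ L^{3/2}((0, T) × ℝ³)`**:
`∫₀ᵀ ‖p̃[u(t)]‖_{3/2}^{3/2} dt ≤ C_{3/2}^{3/2} ∫₀ᵀ ∫ |u(t)|³ < ∞`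
(`eLpNorm_normalisedPressure_threeHalves_le_of_integrable` on the smooth finite-energy slices,
`u ∈ L³` of the slab). [cite: Stein1971, Ch. II §4.2 Thm. 3] -/
theorem lintegral_Ioo_eLpNorm_normalisedPressure_threeHalves_rpow_lt_top
    (H : AxisymmetricL3Hyp ν T u p) :
    ∫⁻ t in Ioo 0 T, eLpNorm (normalisedPressure (u t)) (3 / 2 : ℝ≥0∞) volume ^ (3 / 2 : ℝ)
      < ∞ := by
  set C : ℝ≥0∞ := (steinConstThreeHalves : ℝ≥0∞) with hC
  have hslice : ∀ t ∈ Ioo 0 T,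
      eLpNorm (normalisedPressure (u t)) (3 / 2 : ℝ≥0∞) volume ^ (3 / 2 : ℝ) ≤
        C ^ (3 / 2 : ℝ) * ∫⁻ x, ‖u t x‖ₑ ^ (3 : ℕ) := by
    intro t ht
    have hsm : ContDiff ℝ (⊤ : ℕ∞) (u t) := H.classical.contDiff_velocity ⟨ht.1.le, ht.2⟩
    have h1 := eLpNorm_normalisedPressure_threeHalves_le_of_integrable hsm
      (H.integrable_norm_sq ⟨ht.1.le, ht.2⟩)
    have h3 : ∫⁻ x, ‖u t x‖ₑ ^ (3 : ℕ) = eLpNorm (u t) 3 volume ^ (3 : ℝ) := by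
      rw [← lintegral_enorm_rpow_three_eq_eLpNorm_rpow]
      refine lintegral_congr fun x => ?_
      rw [← ENNReal.rpow_natCast]; norm_num
    calc eLpNorm (normalisedPressure (u t)) (3 / 2 : ℝ≥0∞) volume ^ (3 / 2 : ℝ)
        ≤ (C * eLpNorm (u t) 3 volume ^ 2) ^ (3 / 2 : ℝ) := ENNReal.rpow_le_rpow h1 (by norm_num)
      _ = C ^ (3 / 2 : ℝ) * eLpNorm (u t) 3 volume ^ (3 : ℝ) := by
          rw [ENNReal.mul_rpow_of_nonneg _ _ (by norm_num : (0 : ℝ) ≤ 3 / 2),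
            ← ENNReal.rpow_natCast, ← ENNReal.rpow_mul]
          norm_num
      _ = C ^ (3 / 2 : ℝ) * ∫⁻ x, ‖u t x‖ₑ ^ (3 : ℕ) := by rw [h3]
  calc ∫⁻ t in Ioo 0 T, eLpNorm (normalisedPressure (u t)) (3 / 2 : ℝ≥0∞) volume ^ (3 / 2 : ℝ)
      ≤ ∫⁻ t in Ioo 0 T, C ^ (3 / 2 : ℝ) * ∫⁻ x, ‖u t x‖ₑ ^ (3 : ℕ) :=
        setLIntegral_mono' measurableSet_Ioo fun t ht => hslice t ht
    _ = C ^ (3 / 2 : ℝ) * ∫⁻ t in Ioo 0 T, ∫⁻ x, ‖u t x‖ₑ ^ (3 : ℕ) := by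
        rw [lintegral_const_mul' _ _ (ENNReal.rpow_ne_top_of_nonneg (by norm_num)
          ENNReal.coe_ne_top)]
    _ < ∞ := ENNReal.mul_lt_top (ENNReal.rpow_lt_top_of_nonneg (by norm_num) ENNReal.coe_ne_top)
        H.lintegral_Ioo_lintegral_enorm_pow_three_lt_top

/-! ### Bounds on backward cylinders with top time `T` -/

/-- **`u ∈ L³` of every backward cylinder with top time `T`** (radius `r` with `r² ≤ T`):
`∫∫_{Q_r(T, x₀)} |u|³ ≤ ∫₀ᵀ ∫ |u|³ < ∞`. [cite: SereginSverak2009, Thm 3.1 (hypothesis v ∈ L³(Q))] -/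
theorem lintegral_cylinder_enorm_pow_three_lt_top (H : AxisymmetricL3Hyp ν T u p) {r : ℝ}
    (hr : r ^ 2 ≤ T) (x₀ : ℝ³) :
    ∫⁻ z in parabolicCylinder r ((T : ℝ), x₀), ‖u z.1 z.2‖ₑ ^ (3 : ℕ) < ∞ := by
  have hI : Ioo (T - r ^ 2) T ⊆ Ioo 0 T := Ioo_subset_Ioo_left (by linarith)
  calc ∫⁻ z in parabolicCylinder r ((T : ℝ), x₀), ‖u z.1 z.2‖ₑ ^ (3 : ℕ)
      = ∫⁻ z, ‖u z.1 z.2‖ₑ ^ (3 : ℕ)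
          ∂((volume.restrict (Ioo (T - r ^ 2) T)).prod (volume.restrict (ball x₀ r))) := by
        rw [Measure.prod_restrict, ← Measure.volume_eq_prod]; rfl
    _ ≤ ∫⁻ t in Ioo (T - r ^ 2) T, ∫⁻ x in ball x₀ r, ‖u t x‖ₑ ^ (3 : ℕ) := lintegral_prod_le _
    _ ≤ ∫⁻ t in Ioo 0 T, ∫⁻ x, ‖u t x‖ₑ ^ (3 : ℕ) :=
        (lintegral_mono_set hI).trans (lintegral_mono fun t => setLIntegral_le_lintegral _ _)
    _ < ∞ := H.lintegral_Ioo_lintegral_enorm_pow_three_lt_top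

/-- **Slices of the gauged pressure**: for a.e. `t ∈ (0, T)` and every set `B`,
`∫_B |q(t)|^{3/2} ≤ ‖p̃[u(t)]‖_{3/2}^{3/2}`. [folklore] -/
theorem ae_setLIntegral_gauged_pressure_le_threeHalves
    {q : ℝ → ℝ³ → ℝ} (hq : ∀ᵐ t ∂(volume.restrict (Ioo 0 T)), q t = normalisedPressure (u t))
    (B : Set ℝ³) :
    ∀ᵐ t ∂(volume.restrict (Ioo 0 T)), ∫⁻ x in B, ‖q t x‖ₑ ^ (3 / 2 : ℝ) ≤
      eLpNorm (normalisedPressure (u t)) (3 / 2 : ℝ≥0∞) volume ^ (3 / 2 : ℝ) := by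
  filter_upwards [hq] with t ht
  rw [ht, ← lintegral_enorm_rpow_threeHalves_eq_eLpNorm_rpow]
  exact setLIntegral_le_lintegral _ _

/-- **`q ∈ L^{3/2}` of every backward cylinder with top time `T`** for a gauged pressure `q`
(`q(t) = p̃[u(t)]` a.e. in `t`; radius `r` with `r² ≤ T`) — same statement as in the Type I file,
from `p̃[u] ∈ L^{3/2}` of the slab. [cite: SereginSverak2009, Thm 3.1 (hypothesis q ∈ L^{3/2}(Q))] -/
theorem lintegral_cylinder_gauged_pressure_lt_top (H : AxisymmetricL3Hyp ν T u p)
    {q : ℝ → ℝ³ → ℝ} (hq : ∀ᵐ t ∂(volume.restrict (Ioo 0 T)), q t = normalisedPressure (u t))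
    {r : ℝ} (hr : r ^ 2 ≤ T) (x₀ : ℝ³) :
    ∫⁻ z in parabolicCylinder r ((T : ℝ), x₀), ‖q z.1 z.2‖ₑ ^ (3 / 2 : ℝ) < ∞ := by
  have hI : Ioo (T - r ^ 2) T ⊆ Ioo 0 T := Ioo_subset_Ioo_left (by linarith)
  calc ∫⁻ z in parabolicCylinder r ((T : ℝ), x₀), ‖q z.1 z.2‖ₑ ^ (3 / 2 : ℝ)
      = ∫⁻ z, ‖q z.1 z.2‖ₑ ^ (3 / 2 : ℝ)
          ∂((volume.restrict (Ioo (T - r ^ 2) T)).prod (volume.restrict (ball x₀ r))) := by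
        rw [Measure.prod_restrict, ← Measure.volume_eq_prod]; rfl
    _ ≤ ∫⁻ t in Ioo (T - r ^ 2) T, ∫⁻ x in ball x₀ r, ‖q t x‖ₑ ^ (3 / 2 : ℝ) := lintegral_prod_le _
    _ ≤ ∫⁻ t in Ioo (T - r ^ 2) T,
          eLpNorm (normalisedPressure (u t)) (3 / 2 : ℝ≥0∞) volume ^ (3 / 2 : ℝ) :=
        lintegral_mono_ae (ae_restrict_of_ae_restrict_of_subset hI
          (ae_setLIntegral_gauged_pressure_le_threeHalves hq (ball x₀ r)))
    _ ≤ ∫⁻ t in Ioo 0 T, eLpNorm (normalisedPressure (u t)) (3 / 2 : ℝ≥0∞) volume ^ (3 / 2 : ℝ) :=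
        lintegral_mono_set hI
    _ < ∞ := H.lintegral_Ioo_eLpNorm_normalisedPressure_threeHalves_rpow_lt_top

/-- **`q ∈ L^{3/2}` of the final slab, tail form**: for every set `B ⊆ ℝ³` and `0 ≤ a`,
`∫_{(a, T)} ∫_B |q|^{3/2} ≤ ∫₀ᵀ ‖p̃[u(t)]‖_{3/2}^{3/2} < ∞`. [folklore] -/
theorem lintegral_Ioo_setLIntegral_gauged_pressure_lt_top (H : AxisymmetricL3Hyp ν T u p)
    {q : ℝ → ℝ³ → ℝ} (hq : ∀ᵐ t ∂(volume.restrict (Ioo 0 T)), q t = normalisedPressure (u t))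
    {a : ℝ} (ha : 0 ≤ a) (B : Set ℝ³) :
    ∫⁻ t in Ioo a T, ∫⁻ x in B, ‖q t x‖ₑ ^ (3 / 2 : ℝ) < ∞ := by
  have hI : Ioo a T ⊆ Ioo 0 T := Ioo_subset_Ioo_left ha
  calc ∫⁻ t in Ioo a T, ∫⁻ x in B, ‖q t x‖ₑ ^ (3 / 2 : ℝ)
      ≤ ∫⁻ t in Ioo a T, eLpNorm (normalisedPressure (u t)) (3 / 2 : ℝ≥0∞) volume ^ (3 / 2 : ℝ) :=
        lintegral_mono_ae (ae_restrict_of_ae_restrict_of_subset hI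
          (ae_setLIntegral_gauged_pressure_le_threeHalves hq B))
    _ ≤ ∫⁻ t in Ioo 0 T, eLpNorm (normalisedPressure (u t)) (3 / 2 : ℝ≥0∞) volume ^ (3 / 2 : ℝ) :=
        lintegral_mono_set hI
    _ < ∞ := H.lintegral_Ioo_eLpNorm_normalisedPressure_threeHalves_rpow_lt_top

end AxisymmetricL3Hyp

end Literature.Analysis.FluidPDE

end
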